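import Summits.PneNP.PneNP.Theorems.ExpanderLinearGeneratorsLinearGeneratorDepthFregeHardInstances
import Literature.Computability.MetaComplexity.DepthFregeGaussianElimination
import Literature.Computability.MetaComplexity.FregeMod
import HarnessLib

/-!
# The exponent of the Frege rungs must decay with the depth (calibration of stmt-PneNP-11443 /
stmt-PneNP-11444: their uniform-in-depth strengthenings are FALSE)

Route `PneNP/ExpanderLinearGenerators`, items `LinearGeneratorDepthFregeHard` (stmt-PneNP-11443,
Krajíček's Problem 19.4.5) and `LinearGeneratorModPFregeHard` (stmt-PneNP-11444, the `AC⁰[p]` rung).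
Both conclude, for every depth `d`, a size lower bound `2^{n^ε}` with `ε = ε(ℓ, d, δ)` chosen AFTER
`d`. This file proves that this quantifier order is essential: by the depth-dependent upper bound
`Literature.Computability.MetaComplexity.depthFrege_gaussianElimination` (every unsatisfiable
`ℓ`-sparse system over `𝔽₂` in `n ≤ a^D` variables has depth-`(2D+19)` refutations of size
`((m+2) 2^{(D+1)(2a+3)+ℓ})^{110}`, i.e. `2^{O(D n^{1/D})}` with `a ≈ n^{1/D}`), on the
non-vacuity instances of `…LinearGeneratorDepthFregeHardInstances`
(`linearGeneratorDepthFregeHard_instances`: for every `ℓ ≥ 9`, `δ > 0` and all large `n`, an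
`ℓ`-sparse `(n^{1-δ}, 3ℓ/4)`-boundary-expanding unsolvable system on `n` variables with `m ≤ n`
rows) — i.e. on the WHOLE parameter range where the cruxes have content (`ℓ ≥ 9`):

* `exists_depthProof_rpow` — every unsolvable `ℓ`-sparse system has, at every depth `2D + 19`,
  refutations of size `≤ (m+2)^{110} · 2^{110((D+1)(2(n^{1/D}+1)+3)+ℓ)}`;
* `eps_le_inv_of_depthFrege_lowerBound`, `eps_le_inv_of_modDepthFrege_lowerBound` — for every
  `ℓ ≥ 9`, `δ > 0` and `D ≥ 1`: at depth `2D + 19` every admissible exponent of crux 3, resp. of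
  crux 4 for ANY modulus `p`, is `≤ 1/D`;
* `not_uniform_linearGeneratorDepthFregeHard` — for every `ℓ ≥ 9`, `δ > 0`, the statement
  "`∃ ε > 0 ∀ d ∃ N ∀ n ≥ N …` size `≥ 2^{n^ε}`" (crux 3 with `∃ ε` moved before `∀ d`) is FALSE;
* `not_uniform_linearGeneratorModPFregeHard` — the same for the `textbookFrege(MOD_p)` rung, for
  EVERY modulus `p` (a plain proof is a `MOD_p` proof using no `MOD` axiom).

So any admissible exponent satisfies `ε(ℓ, d, δ) ≤ 2/(d - 19)` for odd `d ≥ 21` (all `ℓ ≥ 9`,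
`δ ∈ (0,1)`): the rungs can only hold in the printed Håstad / GIRS shape `2^{n^{Θ(1/d)}}`. (For
`ℓ ≤ 8` the cruxes are vacuous, `…LocalityEight`, so nothing is claimed there.)

Sources: J. Håstad, J. ACM 68 (2021) (the `2^{n^{Θ(1/d)}}` shape for grids); N. Galesi et al.,
APAL 174 (2023), Thm. 1; the upper bound for general linear systems is folklore (Literature file).
-/

set_option linter.dupNamespace false -- `Summit.PneNP.PneNP.…`: summit = sub-problem (D-0017)

namespace Summit.PneNP.PneNP.Theorems

open Literature.Computability.Complexity Literature.Computability.Complexity.PropForm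
open Literature.Computability.MetaComplexity Filter Topology

/-! ### Subexponential refutations at every depth, in real-exponent form -/

/-- **Refutations of size `2^{O(D n^{1/D})}` at depth `2D + 19`**, for every unsolvable `ℓ`-sparse
system over `𝔽₂` (radix `a = ⌊n^{1/D}⌋ + 1` in `depthFrege_gaussianElimination'`).
[cite: GalesiEtAl2023, Thm. 1 (upper bound)] -/
theorem exists_depthProof_rpow (D : ℕ) (hD : 1 ≤ D) {ℓ m n : ℕ} (E : Fin m → LinEqMod 2 n)
    (hE : ∀ e, (E e).supp.card ≤ ℓ) (hunsat : ¬ SystemSat E Finset.univ) :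
    ∃ π : List (PropForm ℕ),
      textbookFrege.IsDepthProofOf (2 * D + 19) π (neg (PropForm.ofCNF (sumEncoding 1 E))) ∧
      (proofSize π : ℝ) ≤ ((m : ℝ) + 2) ^ 110 *
        (2 : ℝ) ^ (110 * (((D : ℝ) + 1) * (2 * ((n : ℝ) ^ (1 / (D : ℝ)) + 1) + 3) + ℓ)) := by
  set x : ℝ := (n : ℝ) ^ (1 / (D : ℝ)) with hx
  have hx0 : 0 ≤ x := Real.rpow_nonneg (Nat.cast_nonneg n) _
  set a : ℕ := ⌊x⌋₊ + 1 with ha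
  have ha1 : 1 ≤ a := by omega
  have hxa : x < a := by rw [ha]; push_cast; exact Nat.lt_floor_add_one x
  have hax : (a : ℝ) ≤ x + 1 := by rw [ha]; push_cast; linarith [Nat.floor_le hx0]
  have hnD : n ≤ a ^ D := by
    have hD0 : D ≠ 0 := by omega
    have h1 : (n : ℝ) = x ^ D := by
      rw [hx, one_div, Real.rpow_inv_natCast_pow (Nat.cast_nonneg n) hD0]
    have h2 : x ^ D < (a : ℝ) ^ D := pow_lt_pow_left₀ hxa hx0 hD0
    have h3 : (n : ℝ) < (a : ℝ) ^ D := h1 ▸ h2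
    exact_mod_cast h3.le
  obtain ⟨π, hπ, hsize⟩ := depthFrege_gaussianElimination' D ℓ E hE hunsat a ha1 hnD
  refine ⟨π, hπ, ?_⟩
  have hcast : (proofSize π : ℝ) ≤ ((m : ℝ) + 2) ^ 110 * (2 : ℝ) ^ ((110 * ((D + 1) * (2 * a + 3) + ℓ) : ℕ) : ℝ) := by
    rw [Real.rpow_natCast]
    exact_mod_cast hsize
  refine hcast.trans (mul_le_mul_of_nonneg_left ?_ (by positivity))
  refine Real.rpow_le_rpow_of_exponent_le (by norm_num) ?_
  push_cast
  have hD1 : (0 : ℝ) ≤ (D : ℝ) + 1 := by positivity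
  nlinarith [mul_le_mul_of_nonneg_left hax hD1]

/-! ### Asymptotics: `A log₂(n+2) + B (n^{1/D} + 1) + C < n^ε` eventually, for `ε > 1/D` -/

/-- The comparison of the exponents. [folklore] -/
theorem eventually_lt_rpow {ε : ℝ} {D : ℕ} (hD : 1 ≤ D) (hεD : 1 / (D : ℝ) < ε) {A : ℝ} (B C : ℝ)
    (hA : 0 ≤ A) :
    ∃ N : ℕ, ∀ n : ℕ, N ≤ n →
      A * Real.logb 2 ((n : ℝ) + 2) + B * ((n : ℝ) ^ (1 / (D : ℝ)) + 1) + C < (n : ℝ) ^ ε := by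
  have hD0 : (0 : ℝ) < D := by exact_mod_cast hD
  have hε : 0 < ε := lt_trans (by positivity) hεD
  have hl2 : 0 < Real.log 2 := Real.log_pos one_lt_two
  -- the majorant `h n = (A / log 2)(log 2 + log n) + B (n^{1/D} + 1) + C`, divided by `n^ε`, tends to `0`
  have T0 : Tendsto (fun n : ℕ => ((n : ℝ) ^ ε)⁻¹) atTop (𝓝 0) := by
    have h := (tendsto_rpow_neg_atTop hε).comp tendsto_natCast_atTop_atTop
    refine h.congr' ?_
    filter_upwards [eventually_gt_atTop 0] with n hn
    simp [Function.comp, Real.rpow_neg (Nat.cast_nonneg n)]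
  have T1 : Tendsto (fun n : ℕ => Real.log n / (n : ℝ) ^ ε) atTop (𝓝 0) :=
    ((isLittleO_log_rpow_atTop hε).tendsto_div_nhds_zero).comp tendsto_natCast_atTop_atTop
  have T2 : Tendsto (fun n : ℕ => (n : ℝ) ^ (1 / (D : ℝ)) / (n : ℝ) ^ ε) atTop (𝓝 0) := by
    have hpos : 0 < ε - 1 / (D : ℝ) := by linarith
    have h := (tendsto_rpow_neg_atTop hpos).comp tendsto_natCast_atTop_atTop
    refine h.congr' ?_
    filter_upwards [eventually_gt_atTop 0] with n hn
    have hn' : (0 : ℝ) < n := by exact_mod_cast hn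
    simp only [Function.comp]
    rw [eq_div_iff (Real.rpow_pos_of_pos hn' ε).ne', ← Real.rpow_add hn']
    congr 1; ring
  have T : Tendsto (fun n : ℕ => (A / Real.log 2 * Real.log 2 + B + C) * ((n : ℝ) ^ ε)⁻¹ +
      A / Real.log 2 * (Real.log n / (n : ℝ) ^ ε) + B * ((n : ℝ) ^ (1 / (D : ℝ)) / (n : ℝ) ^ ε))
      atTop (𝓝 0) := by
    have := ((T0.const_mul (A / Real.log 2 * Real.log 2 + B + C)).add (T1.const_mul (A / Real.log 2))).add
      (T2.const_mul B)
    simpa using this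
  obtain ⟨N, hN⟩ := eventually_atTop.1 ((tendsto_order.1 T).2 (1 / 2) (by norm_num))
  refine ⟨max N 2, fun n hn => ?_⟩
  have hnN : N ≤ n := le_of_max_le_left hn
  have hn2 : 2 ≤ n := le_of_max_le_right hn
  have hn0 : (0 : ℝ) < n := by exact_mod_cast (show 0 < n by omega)
  have hnε : 0 < (n : ℝ) ^ ε := Real.rpow_pos_of_pos hn0 ε
  have key := hN n hnN
  -- clear the denominator
  have key' : (A / Real.log 2 * Real.log 2 + B + C) + A / Real.log 2 * Real.log n +
      B * (n : ℝ) ^ (1 / (D : ℝ)) < (n : ℝ) ^ ε / 2 := by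
    have e : (A / Real.log 2 * Real.log 2 + B + C) * ((n : ℝ) ^ ε)⁻¹ +
        A / Real.log 2 * (Real.log n / (n : ℝ) ^ ε) + B * ((n : ℝ) ^ (1 / (D : ℝ)) / (n : ℝ) ^ ε) =
        ((A / Real.log 2 * Real.log 2 + B + C) + A / Real.log 2 * Real.log n +
          B * (n : ℝ) ^ (1 / (D : ℝ))) / (n : ℝ) ^ ε := by
      field_simp
    rw [e, div_lt_iff₀ hnε] at key
    linarith
  -- `log₂ (n + 2) ≤ (log 2 + log n) / log 2`
  have hlog : Real.logb 2 ((n : ℝ) + 2) ≤ (Real.log 2 + Real.log n) / Real.log 2 := by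
    rw [Real.logb, div_le_div_iff_of_pos_right hl2, ← Real.log_mul (by norm_num) hn0.ne']
    refine Real.log_le_log (by positivity) ?_
    have : (2 : ℝ) ≤ n := by exact_mod_cast hn2
    linarith
  have hA' : A * Real.logb 2 ((n : ℝ) + 2) ≤ A / Real.log 2 * Real.log 2 + A / Real.log 2 * Real.log n := by
    have := mul_le_mul_of_nonneg_left hlog hA
    refine this.trans (le_of_eq ?_)
    field_simp
  nlinarith [hnε.le]

/-! ### At depth `2D + 19` no exponent above `1/D` is admissible -/

/-- **The exponent at depth `2D + 19` is at most `1/D`.** Let `ℓ ≥ 9`, `δ > 0`. If at depth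
`d = 2D + 19` every depth-`d` `textbookFrege` refutation of every `ℓ`-sparse
`(n^{1-δ}, 3ℓ/4)`-boundary-expanding unsolvable system on `n ≥ N` variables has size `≥ 2^{n^ε}`,
then `ε ≤ 1/D`: otherwise the instances of `linearGeneratorDepthFregeHard_instances` (`m ≤ n` rows)
and their depth-`d` refutations of size `2^{O(D n^{1/D} + log n)}` (`exists_depthProof_rpow`)
contradict the bound for large `n`. So any exponent of `LinearGeneratorDepthFregeHard` at
`(ℓ, d, δ)` satisfies `ε ≤ 2/(d - 19)` (odd `d ≥ 21`). [cite: GalesiEtAl2023, Thm. 1 (upper bound)] -/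
theorem eps_le_inv_of_depthFrege_lowerBound {ℓ : ℕ} (hℓ : 9 ≤ ℓ) {δ : ℝ} (hδ : 0 < δ)
    (D : ℕ) (hD1 : 1 ≤ D) {ε : ℝ}
    (h : ∃ N : ℕ, ∀ n : ℕ, N ≤ n →
      ∀ (m : ℕ) (E : Fin m → LinEqMod 2 n), (∀ i, (E i).supp.card ≤ ℓ) →
        IsBoundaryExpander (fun i => (E i).supp.map Fin.valEmbedding)
          ((n : ℝ) ^ (1 - δ)) (3 / 4 * ℓ) →
        ¬ SystemSat E Finset.univ →
        ∀ π : List (PropForm ℕ),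
          textbookFrege.IsDepthProofOf (2 * D + 19) π (neg (PropForm.ofCNF (sumEncoding 1 E))) →
          (2 : ℝ) ^ ((n : ℝ) ^ ε) ≤ (proofSize π : ℝ)) :
    ε ≤ 1 / (D : ℝ) := by
  by_contra hDε
  push Not at hDε
  obtain ⟨N, hN⟩ := h
  obtain ⟨N₁, hN₁⟩ := eventually_lt_rpow hD1 hDε (A := 110) (220 * ((D : ℝ) + 1))
    (110 * (3 * ((D : ℝ) + 1) + ℓ)) (by norm_num)
  obtain ⟨N₀, hN₀⟩ := linearGeneratorDepthFregeHard_instances hℓ hδ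
  -- a large `n` and an instance on `n` variables with `m ≤ n` rows
  set n := max N (max N₁ N₀) with hn
  have hnN : N ≤ n := le_max_left _ _
  have hnN₁ : N₁ ≤ n := (le_max_left _ _).trans (le_max_right _ _)
  have hn0 : N₀ ≤ n := (le_max_right _ _).trans (le_max_right _ _)
  obtain ⟨m, hm, E, hEℓ, hexp, hunsat⟩ := hN₀ n hn0
  obtain ⟨π, hπ, hsize⟩ := exists_depthProof_rpow D hD1 E hEℓ hunsat
  have hlow := hN n hnN m E hEℓ hexp hunsat π hπ
  have hlt := hN₁ n hnN₁
  -- `size ≤ 2^{f n}` with `f n < n^ε`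
  set f : ℝ := 110 * Real.logb 2 ((n : ℝ) + 2) + 220 * ((D : ℝ) + 1) * ((n : ℝ) ^ (1 / (D : ℝ)) + 1) +
    110 * (3 * ((D : ℝ) + 1) + ℓ) with hf
  have hm2 : (0 : ℝ) < (m : ℝ) + 2 := by positivity
  have hpow : ((m : ℝ) + 2) ^ 110 ≤ (2 : ℝ) ^ (110 * Real.logb 2 ((n : ℝ) + 2)) := by
    have e : ((m : ℝ) + 2) ^ 110 = (2 : ℝ) ^ (110 * Real.logb 2 ((m : ℝ) + 2)) := by
      rw [mul_comm, Real.rpow_mul (by norm_num), Real.rpow_logb (by norm_num) (by norm_num) hm2]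
      norm_cast
    rw [e]
    refine Real.rpow_le_rpow_of_exponent_le (by norm_num) (mul_le_mul_of_nonneg_left ?_ (by norm_num))
    exact Real.logb_le_logb_of_le (by norm_num) hm2
      (by linarith [show (m : ℝ) ≤ n from by exact_mod_cast hm])
  have hsize' : (proofSize π : ℝ) ≤ (2 : ℝ) ^ f := by
    refine hsize.trans ?_
    rw [hf, show 110 * Real.logb 2 ((n : ℝ) + 2) + 220 * ((D : ℝ) + 1) * ((n : ℝ) ^ (1 / (D : ℝ)) + 1) +
        110 * (3 * ((D : ℝ) + 1) + ℓ) = 110 * Real.logb 2 ((n : ℝ) + 2) +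
        110 * (((D : ℝ) + 1) * (2 * ((n : ℝ) ^ (1 / (D : ℝ)) + 1) + 3) + ℓ) by ring,
      Real.rpow_add (by norm_num)]
    exact mul_le_mul_of_nonneg_right hpow (by positivity)
  have hchain : (2 : ℝ) ^ ((n : ℝ) ^ ε) ≤ (2 : ℝ) ^ f := hlow.trans hsize'
  rw [Real.rpow_le_rpow_left_iff one_lt_two] at hchain
  have hf' : f < (n : ℝ) ^ ε := by
    rw [hf]
    have := hlt
    nlinarith [this]
  linarith

/-- The same for the `textbookFrege(MOD_p)` rung, for every modulus `p` (a plain proof is a `MOD_p`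
proof using no `MOD` axiom, of the same depth and size): any exponent of
`LinearGeneratorModPFregeHard` at `(p, ℓ, 2D+19, δ)` is `≤ 1/D` (`ℓ ≥ 9`, `δ > 0`).
[cite: GalesiEtAl2023, Thm. 1 (upper bound)] -/
theorem eps_le_inv_of_modDepthFrege_lowerBound (p : ℕ) {ℓ : ℕ} (hℓ : 9 ≤ ℓ) {δ : ℝ} (hδ : 0 < δ)
    (D : ℕ) (hD1 : 1 ≤ D) {ε : ℝ}
    (h : ∃ N : ℕ, ∀ n : ℕ, N ≤ n →
      ∀ (m : ℕ) (E : Fin m → LinEqMod 2 n), (∀ i, (E i).supp.card ≤ ℓ) →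
        IsBoundaryExpander (fun i => (E i).supp.map Fin.valEmbedding)
          ((n : ℝ) ^ (1 - δ)) (3 / 4 * ℓ) →
        ¬ SystemSat E Finset.univ →
        ∀ π : List (PropFormMod p ℕ),
          textbookFrege.IsModDepthProofOf (2 * D + 19) π
            (PropFormMod.ofPropForm (neg (PropForm.ofCNF (sumEncoding 1 E)))) →
          (2 : ℝ) ^ ((n : ℝ) ^ ε) ≤ (modProofSize π : ℝ)) :
    ε ≤ 1 / (D : ℝ) := by
  refine eps_le_inv_of_depthFrege_lowerBound hℓ hδ D hD1 ?_
  obtain ⟨N, hN⟩ := h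
  refine ⟨N, fun n hn m E hE hexp hunsat π hπ => ?_⟩
  have := hN n hn m E hE hexp hunsat (π.map PropFormMod.ofPropForm) hπ.isModDepthProofOf_map
  rwa [modProofSize_map_ofPropForm] at this

/-! ### The uniform-in-depth strengthenings are false -/

/-- **Crux 3 with `∃ ε` before `∀ d` is false** (for every `ℓ ≥ 9` and `δ > 0`, i.e. wherever
the crux is non-vacuous): no single `ε > 0` serves all depths, since at depth `2D + 19` only `ε ≤ 1/D` is
admissible. Hence the exponent of `LinearGeneratorDepthFregeHard` must decay with the depth.
[cite: GalesiEtAl2023, Thm. 1 (upper bound)] -/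
theorem not_uniform_linearGeneratorDepthFregeHard {ℓ : ℕ} (hℓ : 9 ≤ ℓ) {δ : ℝ} (hδ : 0 < δ) :
    ¬ ∃ ε : ℝ, 0 < ε ∧ ∀ d : ℕ, ∃ N : ℕ, ∀ n : ℕ, N ≤ n →
      ∀ (m : ℕ) (E : Fin m → LinEqMod 2 n), (∀ i, (E i).supp.card ≤ ℓ) →
        IsBoundaryExpander (fun i => (E i).supp.map Fin.valEmbedding)
          ((n : ℝ) ^ (1 - δ)) (3 / 4 * ℓ) →
        ¬ SystemSat E Finset.univ →
        ∀ π : List (PropForm ℕ),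
          textbookFrege.IsDepthProofOf d π (neg (PropForm.ofCNF (sumEncoding 1 E))) →
          (2 : ℝ) ^ ((n : ℝ) ^ ε) ≤ (proofSize π : ℝ) := by
  rintro ⟨ε, hε, h⟩
  -- a depth `2D + 19` with `1/D < ε`
  set D : ℕ := ⌈1 / ε⌉₊ + 1 with hD
  have hD1 : 1 ≤ D := by omega
  have hDε : 1 / (D : ℝ) < ε := by
    have h1 : 1 / ε < (D : ℝ) := by
      rw [hD]; push_cast; exact (Nat.le_ceil _).trans_lt (lt_add_one _)
    have hpos : (0 : ℝ) < D := by positivity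
    rw [div_lt_iff₀ hpos]
    rw [div_lt_iff₀ hε] at h1
    linarith
  have hle := eps_le_inv_of_depthFrege_lowerBound hℓ hδ D hD1 (h (2 * D + 19))
  linarith

/-- **Crux 4 with `∃ ε` before `∀ d` is false, for every modulus `p`.** Hence the exponent of
`LinearGeneratorModPFregeHard` must decay with the depth as well.
[cite: GalesiEtAl2023, Thm. 1 (upper bound)] -/
theorem not_uniform_linearGeneratorModPFregeHard (p : ℕ) {ℓ : ℕ} (hℓ : 9 ≤ ℓ) {δ : ℝ} (hδ : 0 < δ) :
    ¬ ∃ ε : ℝ, 0 < ε ∧ ∀ d : ℕ, ∃ N : ℕ, ∀ n : ℕ, N ≤ n →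
      ∀ (m : ℕ) (E : Fin m → LinEqMod 2 n), (∀ i, (E i).supp.card ≤ ℓ) →
        IsBoundaryExpander (fun i => (E i).supp.map Fin.valEmbedding)
          ((n : ℝ) ^ (1 - δ)) (3 / 4 * ℓ) →
        ¬ SystemSat E Finset.univ →
        ∀ π : List (PropFormMod p ℕ),
          textbookFrege.IsModDepthProofOf d π
            (PropFormMod.ofPropForm (neg (PropForm.ofCNF (sumEncoding 1 E)))) →
          (2 : ℝ) ^ ((n : ℝ) ^ ε) ≤ (modProofSize π : ℝ) := by
  rintro ⟨ε, hε, h⟩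
  refine not_uniform_linearGeneratorDepthFregeHard hℓ hδ ⟨ε, hε, fun d => ?_⟩
  obtain ⟨N, hN⟩ := h d
  refine ⟨N, fun n hn m E hE hexp hunsat π hπ => ?_⟩
  have := hN n hn m E hE hexp hunsat (π.map PropFormMod.ofPropForm) hπ.isModDepthProofOf_map
  rwa [modProofSize_map_ofPropForm] at this

end Summit.PneNP.PneNP.Theorems
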